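import Summits.NavierStokesRegularity.NavierStokesRegularity.Theorems.ScenarioCensusRowA5FsEngine
import HarnessLib

/-!
# Census rows A5fe / A5fi (ns-idea-4 LINE «one-cycle» = the Feller–swirl dictionary) — part 6/7: §3b–§3d the three barrier runs: `farTransport_upper`/`farTransport_of_box` (S3), `coreLeak_of_box` (S2), `criticalFarTransport_of_box` (S3⁰, log profile)

Part 6 of 7 of the port of `OneCycle_v2_3.lean` (sha16 f100b791173babd1); see `ScenarioCensusRowA5FsBox.lean` for the port note.
No census value is asserted here; Row_A5 and NS regularity are NOT proved; no summit statement is proved by this file.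
-/

noncomputable section
set_option linter.dupNamespace false

open MeasureTheory Set Function Filter Topology InnerProductSpace
open scoped Laplacian RealInnerProductSpace ContDiff ENNReal

namespace Summit.NavierStokesRegularity.NavierStokesRegularity.Theorems.ScenarioCensus.FellerSwirl

open Literature.Analysis.FluidPDE
open Summit.NavierStokesRegularity.NavierStokesRegularity.Theorems.ScenarioCensus (Row_A5 Row_A5fe Row_A5fi row_A5fi_of_row_A5fe)

/-- PROVED (g19). **One-sided far transport**: under the eventual inflow bound `m ≤ 2 − δ` on `{r ≥ R₁}`, an upper bound
`F₁` (`0 ≤ F₁ ≤ F`) for `f` on the core `{r ≤ R₁}` is an upper bound everywhere (engine with the far profile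
`F₁ + (F − F₁)(r^δ − R₁^δ)/(R^δ − R₁^δ)` on `[R₁, R]`, then `R → ∞`). -/
theorem farTransport_upper (hS1 : BoxComparison) {f : ℝ → E3 → ℝ} {u : ℝ → E3 → E3}
    {Cg Cu δ R₁ F F₁ : ℝ} (hp : IsSwirlPair f u Cg Cu) (hδ : 0 < δ) (hR₁ : 0 < R₁)
    (hone : ∀ t < 0, ∀ x, R₁ ≤ cylRadius x → -(2 - δ) ≤ x 0 * u t x 0 + x 1 * u t x 1)
    (hF : ∀ t < 0, ∀ x, f t x ≤ F) (hF₁ : ∀ t < 0, ∀ x, cylRadius x ≤ R₁ → f t x ≤ F₁)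
    (hFF : F₁ ≤ F) (hF₁0 : 0 ≤ F₁) :
    ∀ t < 0, ∀ x, f t x ≤ F₁ := by
  intro t ht x
  by_cases hxr : cylRadius x ≤ R₁
  · exact hF₁ t ht x hxr
  push Not at hxr
  set rS := cylRadius x with hrS
  have hrS0 : 0 < rS := hR₁.trans hxr
  have hR : ∀ R : ℝ, rS < R → f t x ≤ F₁ + (F - F₁) * (rS ^ δ - R₁ ^ δ) / (R ^ δ - R₁ ^ δ) := by
    intro R hR
    have hR1R : R₁ < R := hxr.trans hR
    have hden : 0 < R ^ δ - R₁ ^ δ := sub_pos.2 (Real.rpow_lt_rpow hR₁.le hR1R hδ)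
    set c : ℝ := (F - F₁) / (R ^ δ - R₁ ^ δ) with hc
    have hc0 : 0 ≤ c := div_nonneg (sub_nonneg.2 hFF) hden.le
    set q : ℝ → ℝ := fun r => F₁ + c * (r ^ δ - R₁ ^ δ) with hq
    have hqd : ∀ r, 0 < r → HasDerivAt q (c * (δ * r ^ (δ - 1))) r := by
      intro r hr
      have h := (((Real.hasDerivAt_rpow_const (p := δ) (Or.inl hr.ne')).sub_const (R₁ ^ δ)).const_mul c).const_add F₁
      simpa [hq] using h
    have hq1 : ∀ r, 0 < r → deriv q r = c * (δ * r ^ (δ - 1)) := fun r hr => (hqd r hr).deriv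
    have hq2 : ∀ r, 0 < r → iteratedDeriv 2 q r = c * (δ * ((δ - 1) * r ^ (δ - 2))) := by
      intro r hr
      rw [iteratedDeriv_succ, iteratedDeriv_one]
      have hev : deriv q =ᶠ[𝓝 r] fun s => c * (δ * s ^ (δ - 1)) := by
        filter_upwards [Ioi_mem_nhds hr] with s hs using hq1 s hs
      rw [hev.deriv_eq]
      have h := ((Real.hasDerivAt_rpow_const (p := δ - 1) (Or.inl hr.ne')).const_mul δ).const_mul c
      rw [show δ - 1 - 1 = δ - 2 by ring] at h
      exact h.deriv
    have hqC : ContDiffOn ℝ 2 q (Ioi 0) := by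
      intro r hr
      have h1 : ContDiffAt ℝ 2 (fun r : ℝ => r ^ δ) r := Real.contDiffAt_rpow_const_of_ne (ne_of_gt hr)
      exact (contDiffAt_const.add (contDiffAt_const.mul (h1.sub contDiffAt_const))).contDiffWithinAt
    refine (radialBarrier_le hS1 hp hR₁ hR1R.le hqC ?_ ?_ hF ?_ ?_ t ht x hxr.le hR.le).trans (le_of_eq ?_)
    · intro τ hτ y hy1 hy2
      have hy0 : 0 < cylRadius y := hR₁.trans_le hy1
      rw [hq2 _ hy0, hq1 _ hy0]
      have hm : -(y 0 * u τ y 0 + y 1 * u τ y 1) ≤ 2 - δ := by have := hone τ hτ y hy1; linarith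
      have h := farProfile_supersolution hy0 hδ hm
      have e : c * (δ * ((δ - 1) * cylRadius y ^ (δ - 2)))
            + (-(y 0 * u τ y 0 + y 1 * u τ y 1) - 1) / cylRadius y * (c * (δ * cylRadius y ^ (δ - 1)))
          = c * (δ * (δ - 1) * cylRadius y ^ (δ - 2)
            + (-(y 0 * u τ y 0 + y 1 * u τ y 1) - 1) / cylRadius y * (δ * cylRadius y ^ (δ - 1))) := by ring
      rw [e]
      exact mul_nonpos_iff.2 (Or.inl ⟨hc0, h⟩)
    · intro r hr1 hr2
      have : R₁ ^ δ ≤ r ^ δ := Real.rpow_le_rpow hR₁.le hr1 hδ.le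
      show 0 ≤ F₁ + c * (r ^ δ - R₁ ^ δ)
      nlinarith
    · intro τ hτ y hy
      have := hF₁ τ hτ y hy.le
      show f τ y ≤ F₁ + c * (cylRadius y ^ δ - R₁ ^ δ)
      rw [hy, sub_self, mul_zero, add_zero]
      exact this
    · intro τ hτ y hy
      show f τ y ≤ F₁ + c * (cylRadius y ^ δ - R₁ ^ δ)
      rw [hy, hc, div_mul_cancel₀ _ hden.ne']
      linarith [hF τ hτ y]
    · show F₁ + c * (rS ^ δ - R₁ ^ δ) = _
      rw [hc]; ring
  -- `R → ∞`
  refine le_of_forall_pos_lt_add fun ε hε => ?_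
  have hlim : Tendsto (fun R : ℝ => (F - F₁) * (rS ^ δ - R₁ ^ δ) / (R ^ δ - R₁ ^ δ)) atTop (𝓝 0) := by
    refine Tendsto.div_atTop tendsto_const_nhds ?_
    have := tendsto_atTop_add_const_right atTop (-(R₁ ^ δ)) (tendsto_rpow_atTop hδ)
    simpa [sub_eq_add_neg] using this
  obtain ⟨R, hR1, hR2⟩ := ((hlim.eventually (gt_mem_nhds hε)).and (eventually_gt_atTop rS)).exists
  have := hR R hR2
  linarith

/-- PROVED (g19). S3 = `BoxComparison → FarTransport` (the one-sided lemma for `f` and for `−f`). -/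
theorem farTransport_of_box : BoxComparison → FarTransport := by
  intro hS1 f u Cg Cu δ R₁ F F₁ hp hδ hR₁ hone hF hF₁ t ht x
  have hF₁0 : 0 ≤ F₁ := by
    have h0 : cylRadius (0 : E3) = 0 := by simp [cylRadius]
    have := hF₁ t ht 0 (by rw [h0]; exact hR₁.le)
    exact (abs_nonneg _).trans this
  by_cases hFF : F₁ ≤ F
  · rw [abs_le]
    constructor
    · have h : -f t x ≤ F₁ := farTransport_upper hS1 hp.neg hδ hR₁ hone
        (fun s hs y => (neg_le_abs _).trans (hF s hs y))
        (fun s hs y hy => (neg_le_abs _).trans (hF₁ s hs y hy)) hFF hF₁0 t ht x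
      linarith
    · exact farTransport_upper hS1 hp hδ hR₁ hone (fun s hs y => (le_abs_self _).trans (hF s hs y))
        (fun s hs y hy => (le_abs_self _).trans (hF₁ s hs y hy)) hFF hF₁0 t ht x
  · push Not at hFF
    exact (hF t ht x).trans hFF.le

/-! ## §3c (g19, PROVED) S2 — the CORE LEAK by the same engine: core profile `η + F(1 − ψ(r))` on `[a, L]`,
`ψ = corePsi c L`, `c = |C_u| + 1`, `L = R₁ + 1`; inner face paid by the axis clause `|f| ≤ C_g a`; then `a ↓ 0`;
`p₀ = ψ(R₁) = coreLeakFraction C_u R₁`. No one-sided hypothesis is used. -/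

/-- PROVED. `G` is `C²`. -/
theorem contDiff_coreG (c : ℝ) : ContDiff ℝ 2 (coreG c) := by
  show ContDiff ℝ 2 (fun ρ => (c * ρ + 1) * Real.exp (-(c * ρ)) / c ^ 2)
  exact (((contDiff_const.mul contDiff_id).add contDiff_const).mul
    (Real.contDiff_exp.comp ((contDiff_const.mul contDiff_id).neg))).div_const _

/-- PROVED. `ψ` is `C²`. -/
theorem contDiff_corePsi (c L : ℝ) : ContDiff ℝ 2 (corePsi c L) := by
  show ContDiff ℝ 2 (fun r => (coreG c r - coreG c L) / (coreG c 0 - coreG c L))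
  exact ((contDiff_coreG c).sub contDiff_const).div_const _

/-- PROVED. The normalising denominator of `ψ` is positive. -/
theorem coreG_denom_pos {c L : ℝ} (hc : 0 < c) (hL : 0 < L) : 0 < coreG c 0 - coreG c L :=
  sub_pos.2 (strictAntiOn_coreG hc (le_refl (0:ℝ)) hL.le hL)

/-- PROVED. `ψ ≤ 1` on `[0, ∞)`. -/
theorem corePsi_le_one {c L r : ℝ} (hc : 0 < c) (hL : 0 < L) (hr : 0 ≤ r) : corePsi c L r ≤ 1 := by
  have hD := coreG_denom_pos hc hL
  have h1 : coreG c r ≤ coreG c 0 := (strictAntiOn_coreG hc).antitoneOn (le_refl (0:ℝ)) hr hr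
  unfold corePsi
  rw [div_le_one hD]
  linarith

/-- PROVED. `ψ` is non-increasing on `[0, ∞)`. -/
theorem corePsi_antitone {c L r₁ r₂ : ℝ} (hc : 0 < c) (hL : 0 < L) (hr₁ : 0 ≤ r₁) (h : r₁ ≤ r₂) :
    corePsi c L r₂ ≤ corePsi c L r₁ := by
  have hD := coreG_denom_pos hc hL
  have h1 : coreG c r₂ ≤ coreG c r₁ := (strictAntiOn_coreG hc).antitoneOn hr₁ (hr₁.trans h) h
  unfold corePsi
  exact div_le_div_of_nonneg_right (by linarith) hD.le

/-- PROVED. `d/dr (r e^{−cr}/D) = e^{−cr}(1 − cr)/D`. -/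
theorem hasDerivAt_corePsi' (c D r : ℝ) :
    HasDerivAt (fun r => r * Real.exp (-(c * r)) / D) (Real.exp (-(c * r)) * (1 - c * r) / D) r := by
  have h1 : HasDerivAt (fun r => -(c * r)) (-(c * 1)) r := (((hasDerivAt_id' r).const_mul c).neg)
  have h2 := ((hasDerivAt_id' r).mul h1.exp).div_const D
  exact h2.congr_deriv (by ring)

/-- PROVED (g19). **One-sided core leak**: for a swirl pair with `f ≤ F` everywhere, on the core `{r ≤ R₁}` one has
`f ≤ (1 − ψ(R₁)) F`, `ψ = corePsi (|C_u|+1) (R₁+1)` (engine on `[a, R₁ + 1]` with `η + F(1 − ψ)`, `η = max C_g 0 · a`,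
then `a ↓ 0`, then monotonicity of `ψ`). -/
theorem coreLeak_upper (hS1 : BoxComparison) {f : ℝ → E3 → ℝ} {u : ℝ → E3 → E3} {Cg Cu R₁ F : ℝ}
    (hp : IsSwirlPair f u Cg Cu) (hR₁ : 0 < R₁) (hfle : ∀ t < 0, ∀ x, f t x ≤ |f t x|)
    (hF : ∀ t < 0, ∀ x, |f t x| ≤ F) (hax : ∀ t < 0, ∀ x, f t x ≤ Cg * cylRadius x) :
    ∀ t < 0, ∀ x, cylRadius x ≤ R₁ → f t x ≤ (1 - coreLeakFraction Cu R₁) * F := by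
  intro t ht x hxR
  set c : ℝ := |Cu| + 1 with hc
  have hc0 : 0 < c := by positivity
  set L : ℝ := R₁ + 1 with hL
  have hL0 : 0 < L := by positivity
  have hD := coreG_denom_pos hc0 hL0
  set D : ℝ := coreG c 0 - coreG c L with hDdef
  set ψ : ℝ → ℝ := corePsi c L with hψ
  have hF0 : 0 ≤ F := by
    have h0 : cylRadius (0 : E3) = 0 := by simp [cylRadius]
    have h1 : |f t 0| ≤ Cg * cylRadius (0 : E3) := hp.axis t ht 0
    rw [h0, mul_zero] at h1
    exact (le_trans (abs_nonneg _) (hF t ht 0))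
  have hF' : ∀ s < 0, ∀ y, f s y ≤ F := fun s hs y => (hfle s hs y).trans (hF s hs y)
  set rS := cylRadius x with hrS
  have hp0frac : coreLeakFraction Cu R₁ = ψ R₁ := rfl
  -- on the axis the claim is trivial
  rcases (cylRadius_nonneg x).eq_or_lt with h0 | hrS0
  · have h1 : f t x ≤ Cg * cylRadius x := hax t ht x
    rw [← h0, mul_zero] at h1
    have hp01 : ψ R₁ < 1 := (coreLeakFraction_mem_Ioo Cu hR₁).2
    rw [hp0frac]
    nlinarith
  -- the engine on `[a, L]` for every `0 < a ≤ rS`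
  set Cg' : ℝ := max Cg 0 with hCg'
  have hCg'0 : 0 ≤ Cg' := le_max_right _ _
  have ha : ∀ a : ℝ, 0 < a → a ≤ rS → f t x ≤ Cg' * a + F * (1 - ψ rS) := by
    intro a ha0 harS
    set η : ℝ := Cg' * a with hη
    have hη0 : 0 ≤ η := mul_nonneg hCg'0 ha0.le
    set q : ℝ → ℝ := fun r => η + F * (1 - ψ r) with hq
    have haL : a ≤ L := by linarith
    -- derivatives of `q`
    have hψd : ∀ r, HasDerivAt ψ (-(r * Real.exp (-(c * r))) / D) r := fun r =>
      hasDerivAt_corePsi hc0.ne' L r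
    have hqd : ∀ r, HasDerivAt q (F * (r * Real.exp (-(c * r)) / D)) r := by
      intro r
      have h := (((hψd r).const_sub 1).const_mul F).const_add η
      exact h.congr_deriv (by ring)
    have hq1 : deriv q = fun r => F * (r * Real.exp (-(c * r)) / D) := funext fun r => (hqd r).deriv
    have hq2 : ∀ r, iteratedDeriv 2 q r = F * (Real.exp (-(c * r)) * (1 - c * r) / D) :=
      iteratedDeriv_two_eq hqd (fun r => (hasDerivAt_corePsi' c D r).const_mul F)
    have hqC : ContDiffOn ℝ 2 q (Ioi 0) :=
      (contDiff_const.add (contDiff_const.mul (contDiff_const.sub (contDiff_corePsi c L)))).contDiffOn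
    have hψle1 : ∀ r, 0 ≤ r → ψ r ≤ 1 := fun r hr => corePsi_le_one hc0 hL0 hr
    refine (radialBarrier_le hS1 hp ha0 haL hqC ?_ ?_ hF' ?_ ?_ t ht x harS (by linarith)).trans (le_of_eq rfl)
    · -- super-solution inequality from `m ≤ c r`
      intro τ hτ y hy1 hy2
      have hy0 : 0 < cylRadius y := ha0.trans_le hy1
      set r := cylRadius y with hr
      set m : ℝ := -(y 0 * u τ y 0 + y 1 * u τ y 1) with hm
      have hmle : m ≤ c * r := by
        have h1 : |m| ≤ r * |Cu| := by
          rw [hm, abs_neg]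
          exact (abs_inflow_le y (u τ y)).trans
            (mul_le_mul_of_nonneg_left ((hp.drift τ hτ y).trans (le_abs_self _)) (cylRadius_nonneg y))
        have h2 : m ≤ |m| := le_abs_self m
        rw [hc]
        nlinarith
      rw [hq2, hq1]
      have e : F * (Real.exp (-(c * r)) * (1 - c * r) / D) + (m - 1) / r * (F * (r * Real.exp (-(c * r)) / D))
          = F * Real.exp (-(c * r)) / D * (m - c * r) := by
        field_simp
        ring
      rw [e]
      exact mul_nonpos_iff.2 (Or.inl ⟨div_nonneg (mul_nonneg hF0 (Real.exp_pos _).le) hD.le, by linarith⟩)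
    · -- `q ≥ 0` on `[a, L]`
      intro r hr1 _
      have := hψle1 r (ha0.le.trans hr1)
      show 0 ≤ η + F * (1 - ψ r)
      nlinarith
    · -- inner face `r = a`: the axis clause
      intro τ hτ y hy
      have h1 : f τ y ≤ Cg * cylRadius y := hax τ hτ y
      have h2 : Cg * cylRadius y ≤ Cg' * a := by
        rw [hy]; exact mul_le_mul_of_nonneg_right (le_max_left _ _) ha0.le
      have h3 : 0 ≤ F * (1 - ψ (cylRadius y)) := mul_nonneg hF0 (by linarith [hψle1 _ (cylRadius_nonneg y)])
      show f τ y ≤ η + F * (1 - ψ (cylRadius y))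
      linarith
    · -- outer face `r = L`: `ψ(L) = 0`
      intro τ hτ y hy
      have hψL : ψ L = 0 := (corePsi_zero_and_L hc0 hL0).2
      show f τ y ≤ η + F * (1 - ψ (cylRadius y))
      rw [hy, hψL]
      linarith [hF' τ hτ y]
  -- `a ↓ 0`
  have hlim : f t x ≤ F * (1 - ψ rS) := by
    refine le_of_forall_pos_lt_add fun ε hε => ?_
    set a : ℝ := min rS (ε / (Cg' + 1)) with haDef
    have ha0 : 0 < a := lt_min hrS0 (by positivity)
    have h1 := ha a ha0 (min_le_left _ _)
    have h2 : Cg' * a ≤ Cg' * (ε / (Cg' + 1)) := mul_le_mul_of_nonneg_left (min_le_right _ _) hCg'0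
    have h3 : Cg' * (ε / (Cg' + 1)) < ε := by
      rw [mul_div_assoc', div_lt_iff₀ (by positivity)]
      nlinarith
    linarith
  -- monotonicity of `ψ`
  have hmono : ψ R₁ ≤ ψ rS := corePsi_antitone hc0 hL0 hrS0.le hxR
  rw [hp0frac]
  nlinarith

/-- PROVED (g19). S2 = `BoxComparison → CoreLeak` (the one-sided lemma for `f` and for `−f`). -/
theorem coreLeak_of_box : BoxComparison → CoreLeak := by
  intro hS1 Cu R₁ hR₁
  refine ⟨coreLeakFraction Cu R₁, (coreLeakFraction_mem_Ioo Cu hR₁).1, (coreLeakFraction_mem_Ioo Cu hR₁).2, ?_⟩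
  intro f u Cg F hp hF t ht x hx
  rw [abs_le]
  constructor
  · have h : -f t x ≤ (1 - coreLeakFraction Cu R₁) * F :=
      coreLeak_upper hS1 hp.neg hR₁ (fun s hs y => by simpa using neg_le_abs (f s y))
        (fun s hs y => by simpa using hF s hs y)
        (fun s hs y => (neg_le_abs (f s y)).trans (hp.axis s hs y)) t ht x hx
    linarith
  · exact coreLeak_upper hS1 hp hR₁ (fun s hs y => le_abs_self _) hF
      (fun s hs y => (le_abs_self _).trans (hp.axis s hs y)) t ht x hx

/-! ## §3d (g19, v2.3 — PROVED) S3⁰ — CRITICAL far transport (inflow number `≤ 2` exactly) by the same engine with the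
LOG profile `F₁ + (F − F₁)(log r − log R₁)/(log R − log R₁)` on `[R₁, R]`: `q″ + ((m−1)/r) q′ = c (m − 2)/r² ≤ 0` for
`m ≤ 2`; then `R → ∞` (dimension two is still recurrent: `log r → ∞`). -/

/-- PROVED (g19). **One-sided critical far transport.** -/
theorem criticalFarTransport_upper (hS1 : BoxComparison) {f : ℝ → E3 → ℝ} {u : ℝ → E3 → E3}
    {Cg Cu R₁ F F₁ : ℝ} (hp : IsSwirlPair f u Cg Cu) (hR₁ : 0 < R₁)
    (hone : ∀ t < 0, ∀ x, R₁ ≤ cylRadius x → -2 ≤ x 0 * u t x 0 + x 1 * u t x 1)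
    (hF : ∀ t < 0, ∀ x, f t x ≤ F) (hF₁ : ∀ t < 0, ∀ x, cylRadius x ≤ R₁ → f t x ≤ F₁)
    (hFF : F₁ ≤ F) (hF₁0 : 0 ≤ F₁) :
    ∀ t < 0, ∀ x, f t x ≤ F₁ := by
  intro t ht x
  by_cases hxr : cylRadius x ≤ R₁
  · exact hF₁ t ht x hxr
  push Not at hxr
  set rS := cylRadius x with hrS
  have hrS0 : 0 < rS := hR₁.trans hxr
  have hR : ∀ R : ℝ, rS < R →
      f t x ≤ F₁ + (F - F₁) * (Real.log rS - Real.log R₁) / (Real.log R - Real.log R₁) := by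
    intro R hR
    have hR1R : R₁ < R := hxr.trans hR
    have hden : 0 < Real.log R - Real.log R₁ := sub_pos.2 (Real.log_lt_log hR₁ hR1R)
    set c : ℝ := (F - F₁) / (Real.log R - Real.log R₁) with hc
    have hc0 : 0 ≤ c := div_nonneg (sub_nonneg.2 hFF) hden.le
    set q : ℝ → ℝ := fun r => F₁ + c * (Real.log r - Real.log R₁) with hq
    have hqd : ∀ r, 0 < r → HasDerivAt q (c * r⁻¹) r := by
      intro r hr
      have h := (((Real.hasDerivAt_log hr.ne').sub_const (Real.log R₁)).const_mul c).const_add F₁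
      simpa [hq] using h
    have hq1 : ∀ r, 0 < r → deriv q r = c * r⁻¹ := fun r hr => (hqd r hr).deriv
    have hq2 : ∀ r, 0 < r → iteratedDeriv 2 q r = c * (-(r ^ 2)⁻¹) := by
      intro r hr
      rw [iteratedDeriv_succ, iteratedDeriv_one]
      have hev : deriv q =ᶠ[𝓝 r] fun s => c * s⁻¹ := by
        filter_upwards [Ioi_mem_nhds hr] with s hs using hq1 s hs
      rw [hev.deriv_eq]
      exact ((hasDerivAt_inv hr.ne').const_mul c).deriv
    have hqC : ContDiffOn ℝ 2 q (Ioi 0) := by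
      have hlog : ContDiffOn ℝ 2 Real.log (Ioi (0:ℝ)) :=
        Real.contDiffOn_log.mono fun r hr => ne_of_gt (mem_Ioi.1 hr)
      exact contDiffOn_const.add (contDiffOn_const.mul (hlog.sub contDiffOn_const))
    refine (radialBarrier_le hS1 hp hR₁ hR1R.le hqC ?_ ?_ hF ?_ ?_ t ht x hxr.le hR.le).trans (le_of_eq ?_)
    · intro τ hτ y hy1 hy2
      have hy0 : 0 < cylRadius y := hR₁.trans_le hy1
      rw [hq2 _ hy0, hq1 _ hy0]
      have hm : -(y 0 * u τ y 0 + y 1 * u τ y 1) ≤ 2 := by have := hone τ hτ y hy1; linarith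
      have e : c * (-(cylRadius y ^ 2)⁻¹)
            + (-(y 0 * u τ y 0 + y 1 * u τ y 1) - 1) / cylRadius y * (c * (cylRadius y)⁻¹)
          = c * ((-(y 0 * u τ y 0 + y 1 * u τ y 1) - 2) / cylRadius y ^ 2) := by
        field_simp
        ring
      rw [e]
      exact mul_nonpos_iff.2 (Or.inl ⟨hc0, div_nonpos_of_nonpos_of_nonneg (by linarith) (sq_nonneg _)⟩)
    · intro r hr1 hr2
      have : Real.log R₁ ≤ Real.log r := Real.log_le_log hR₁ hr1
      show 0 ≤ F₁ + c * (Real.log r - Real.log R₁)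
      nlinarith
    · intro τ hτ y hy
      have := hF₁ τ hτ y hy.le
      show f τ y ≤ F₁ + c * (Real.log (cylRadius y) - Real.log R₁)
      rw [hy, sub_self, mul_zero, add_zero]
      exact this
    · intro τ hτ y hy
      show f τ y ≤ F₁ + c * (Real.log (cylRadius y) - Real.log R₁)
      rw [hy, hc, div_mul_cancel₀ _ hden.ne']
      linarith [hF τ hτ y]
    · show F₁ + c * (Real.log rS - Real.log R₁) = _
      rw [hc]; ring
  -- `R → ∞`: `log R → ∞`
  refine le_of_forall_pos_lt_add fun ε hε => ?_
  have hlim : Tendsto (fun R : ℝ => (F - F₁) * (Real.log rS - Real.log R₁) / (Real.log R - Real.log R₁))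
      atTop (𝓝 0) := by
    refine Tendsto.div_atTop tendsto_const_nhds ?_
    have := tendsto_atTop_add_const_right atTop (-(Real.log R₁)) Real.tendsto_log_atTop
    simpa [sub_eq_add_neg] using this
  obtain ⟨R, hR1, hR2⟩ := ((hlim.eventually (gt_mem_nhds hε)).and (eventually_gt_atTop rS)).exists
  have := hR R hR2
  linarith

/-- PROVED (g19). S3⁰ = `BoxComparison → CriticalFarTransport` (for `f` and `−f`). -/
theorem criticalFarTransport_of_box : BoxComparison → CriticalFarTransport := by
  intro hS1 f u Cg Cu R₁ F F₁ hp hR₁ hone hF hF₁ t ht x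
  have hF₁0 : 0 ≤ F₁ := by
    have h0 : cylRadius (0 : E3) = 0 := by simp [cylRadius]
    have := hF₁ t ht 0 (by rw [h0]; exact hR₁.le)
    exact (abs_nonneg _).trans this
  by_cases hFF : F₁ ≤ F
  · rw [abs_le]
    constructor
    · have h : -f t x ≤ F₁ := criticalFarTransport_upper hS1 hp.neg hR₁ hone
        (fun s hs y => (neg_le_abs _).trans (hF s hs y))
        (fun s hs y hy => (neg_le_abs _).trans (hF₁ s hs y hy)) hFF hF₁0 t ht x
      linarith
    · exact criticalFarTransport_upper hS1 hp hR₁ hone (fun s hs y => (le_abs_self _).trans (hF s hs y))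
        (fun s hs y hy => (le_abs_self _).trans (hF₁ s hs y hy)) hFF hF₁0 t ht x
  · push Not at hFF
    exact (hF t ht x).trans hFF.le


end Summit.NavierStokesRegularity.NavierStokesRegularity.Theorems.ScenarioCensus.FellerSwirl

end
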